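import Summits.ResolutionOfSingularities.ResolutionOfSingularities.Theorems.FolLU.Negative.SameModel
import Literature.AlgebraicGeometry.Resolution.RegularLocalRingsQuotient
import HarnessLib

/-!
# Crux `DualSandwich` (stmt-ResolutionOfSingularities-17083) — naive descent is false: SET-UP

Route `ResolutionOfSingularities/FoliationDescent`, crux #4 `DualSandwich`. Infrastructure for the
negative lemma `naiveDescent_false` (file `NaiveDescent.lean` in this directory), which shows that
the trace `B ∩ F` of a regular model `B` of `L` on the bottom `F` of a height-one Frobenius
sandwich `F ⊆ L` need not be regular at the centre (witness: the `A₁` / `μ₂`-quotient point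
`𝔽₂[X₀², X₀X₁, X₁²] = 𝔽₂[X₀, X₁] ∩ 𝔽₂(X₀², X₀X₁)`):

* the Euler operator `X₀∂₀ + X₁∂₁` on `𝔽₂[X₀,X₁]` — its coefficients (`coeff_euler`), its
  constants are the EVEN polynomials (`coeff_eq_zero_of_euler_eq_zero`), a non-zero even polynomial
  without constant term has order `≥ 2` (`two_le_ordN`, on top of the order valuation of
  `Theorems/FolLU/Negative/SameModelSetup.lean`), it kills `X₀X₁` (`euler_X0_mul_X1`), and it
  extends to a derivation `E` of `L = 𝔽₂(X₀,X₁)` (`exists_euler`, via the tree's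
  `Derivation.fractionFieldExtend`);
* the divisibility fact `X₀X₁·s = a·X₀² ⇒ s(0) = 0` (`constantCoeff_eq_zero_of_mul_eq`);
* the commutative algebra of the non-regularity argument, over an ABSTRACT regular local ring
  (one `CommRing` instance in scope, so that no `Localization` instance paths are compared):
  `map_mem_span_of_sq_eq` — for `x ∈ 𝔪 ∖ 𝔪²` of a regular local ring, `(x)` is prime
  (Matsumura 14.2: `R/(x)` regular, tree `IsRegularLocalRing.quotient_span_singleton`; 14.3:
  regular ⇒ domain, tree `isDomain_of_isRegularLocalRing`), in pulled-back form; and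
  `exists_mul_eq_mul_of_isRegularLocalRing` — its translation to the base of a localization at a
  prime (`IsLocalization.AtPrime.map_eq_maximalIdeal`, `algebraMap_mem_map_algebraMap_iff`).

Definition-free, kernel-only, no facts. Refuter seat
refuter-cdisprove-stmt-ResolutionOfSingularities-17083-g2-0 (cdisprove gen 2), 2026-08-17.
-/

set_option linter.dupNamespace false

namespace Summit.ResolutionOfSingularities.ResolutionOfSingularities.Theorems

noncomputable section

open MvPolynomial WithZero IsLocalRing
open FolLUSameModelNeg

namespace DualSandwichNaiveDescentNeg

/-! ### Polynomial side: the Euler operator `X₀∂₀ + X₁∂₁` on `𝔽₂[X₀,X₁]` -/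

/-- Coefficients of `Xᵢ ∂ᵢ g`: `coeff m (Xᵢ ∂ᵢ g) = mᵢ · coeff m g`. [folklore] -/
theorem coeff_X_mul_pderiv (g : (MvPolynomial (Fin 2) (ZMod 2))) (i : Fin 2) (m : Fin 2 →₀ ℕ) :
    coeff m (X i * pderiv i g) = ((m i : ℕ) : ZMod 2) * coeff m g := by
  classical
  rw [coeff_X_mul']
  split_ifs with hi
  · rw [Finsupp.mem_support_iff] at hi
    have hle : Finsupp.single i 1 ≤ m := by
      rw [Finsupp.single_le_iff]; omega
    rw [coeff_pderiv, tsub_add_cancel_of_le hle, mul_comm]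
    congr 1
    have : ((m - Finsupp.single i 1 : Fin 2 →₀ ℕ) : Fin 2 → ℕ) i + 1 = m i := by
      rw [Finsupp.coe_tsub, Pi.sub_apply, Finsupp.single_eq_same]; omega
    exact_mod_cast congrArg (fun n : ℕ => (n : ZMod 2)) this
  · rw [Finsupp.mem_support_iff, not_not] at hi
    rw [hi, Nat.cast_zero, zero_mul]

/-- Coefficients of the Euler operator: `coeff m (X₀∂₀ g + X₁∂₁ g) = |m| · coeff m g`. [folklore] -/
theorem coeff_euler (g : (MvPolynomial (Fin 2) (ZMod 2))) (m : Fin 2 →₀ ℕ) :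
    coeff m (X 0 * pderiv 0 g + X 1 * pderiv 1 g) = ((m 0 + m 1 : ℕ) : ZMod 2) * coeff m g := by
  rw [coeff_add, coeff_X_mul_pderiv, coeff_X_mul_pderiv, Nat.cast_add, add_mul]

/-- An Euler constant in characteristic two is an EVEN polynomial: its monomials of odd total
degree vanish. [folklore] -/
theorem coeff_eq_zero_of_euler_eq_zero {g : (MvPolynomial (Fin 2) (ZMod 2))} (hg : X 0 * pderiv 0 g + X 1 * pderiv 1 g = 0)
    {m : Fin 2 →₀ ℕ} (hm : Odd (m 0 + m 1)) : coeff m g = 0 := by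
  have h := coeff_euler g m
  rw [hg, coeff_zero, (ZMod.natCast_eq_one_iff_odd).mpr hm, one_mul] at h
  exact h.symm

/-- A non-zero even polynomial without constant term has order `≥ 2`. [folklore] -/
theorem two_le_ordN {g : (MvPolynomial (Fin 2) (ZMod 2))} (hg0 : g ≠ 0) (hc : constantCoeff g = 0)
    (hodd : ∀ m : Fin 2 →₀ ℕ, Odd (m 0 + m 1) → coeff m g = 0) :
    2 ≤ (g : MvPowerSeries (Fin 2) (ZMod 2)).order.toNat := by
  have h := le_ord (a := g) (n := 2) (by
    intro m hm
    have hdeg : Finsupp.degree m = m 0 + m 1 := by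
      rw [Finsupp.degree_eq_sum, Fin.sum_univ_two]
    rw [hdeg] at hm
    rcases Nat.lt_succ_iff_lt_or_eq.mp hm with h1 | h1
    · have h0 : m 0 + m 1 = 0 := by omega
      have hm0 : m = 0 := by
        rw [← Finsupp.degree_eq_zero_iff, hdeg, h0]
      rw [hm0, ← MvPolynomial.constantCoeff_eq]
      exact hc
    · exact hodd m (by rw [h1]; exact odd_one))
  rw [← ordN_spec hg0] at h
  exact_mod_cast h

/-- `X₀ X₁ s = a X₀²` forces `s(0) = 0` (`X₀` is prime and does not divide `X₁`). [folklore] -/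
theorem constantCoeff_eq_zero_of_mul_eq {a s : (MvPolynomial (Fin 2) (ZMod 2))} (h : X 0 * X 1 * s = a * X 0 ^ 2) :
    constantCoeff s = 0 := by
  have hp : Prime (X 0 : (MvPolynomial (Fin 2) (ZMod 2))) := X_prime
  have h1 : (X 1 : (MvPolynomial (Fin 2) (ZMod 2))) * s = a * X 0 := by
    have h2 : (X 0 : (MvPolynomial (Fin 2) (ZMod 2))) * (X 1 * s) = X 0 * (a * X 0) := by rw [← mul_assoc, h]; ring
    exact mul_left_cancel₀ (X_ne_zero (0 : Fin 2)) h2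
  have hd : (X 0 : (MvPolynomial (Fin 2) (ZMod 2))) ∣ X 1 * s := ⟨a, by rw [h1, mul_comm]⟩
  rcases hp.dvd_or_dvd hd with h3 | h3
  · exact absurd (X_dvd_X.mp h3) (by decide)
  · obtain ⟨q, rfl⟩ := h3
    rw [map_mul, constantCoeff_X, zero_mul]

/-- `X₀∂₀ + X₁∂₁` kills `X₀ X₁` in characteristic two. [folklore] -/
theorem euler_X0_mul_X1 : (X 0 * pderiv 0 (X 0 * X 1) + X 1 * pderiv 1 (X 0 * X 1) : (MvPolynomial (Fin 2) (ZMod 2))) = 0 := by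
  have h01 : pderiv 0 (X 1 : (MvPolynomial (Fin 2) (ZMod 2))) = 0 := pderiv_X_of_ne (show (1 : Fin 2) ≠ 0 by decide)
  have h10 : pderiv 1 (X 0 : (MvPolynomial (Fin 2) (ZMod 2))) = 0 := pderiv_X_of_ne (show (0 : Fin 2) ≠ 1 by decide)
  simp only [Derivation.leibniz, smul_eq_mul, pderiv_X_self, h01, h10, mul_zero, mul_one,
    zero_add, add_zero]
  rw [mul_comm (X 1) (X 0)]
  exact CharTwo.add_self_eq_zero _

/-! ### The Euler derivation of `L = 𝔽₂(X₀, X₁)` -/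

/-- **The Euler derivation exists**: a `𝔽₂`-derivation `E` of `L` extending `X₀∂₀ + X₁∂₁`.
[folklore] -/
theorem exists_euler : ∃ E : Derivation (ZMod 2) (FractionRing (MvPolynomial (Fin 2) (ZMod 2))) (FractionRing (MvPolynomial (Fin 2) (ZMod 2))), ∀ a : (MvPolynomial (Fin 2) (ZMod 2)),
    E (algebraMap (MvPolynomial (Fin 2) (ZMod 2)) (FractionRing (MvPolynomial (Fin 2) (ZMod 2))) a) = algebraMap (MvPolynomial (Fin 2) (ZMod 2)) (FractionRing (MvPolynomial (Fin 2) (ZMod 2))) (X 0 * pderiv 0 a + X 1 * pderiv 1 a) := by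
  let d₀ : Derivation (ZMod 2) (MvPolynomial (Fin 2) (ZMod 2)) (MvPolynomial (Fin 2) (ZMod 2)) := (X 0 : (MvPolynomial (Fin 2) (ZMod 2))) • pderiv 0 + (X 1 : (MvPolynomial (Fin 2) (ZMod 2))) • pderiv 1
  have d₀_apply : ∀ a, d₀ a = X 0 * pderiv 0 a + X 1 * pderiv 1 a := fun a => by
    simp [d₀, smul_eq_mul]
  let dK : Derivation (ZMod 2) (MvPolynomial (Fin 2) (ZMod 2)) (FractionRing (MvPolynomial (Fin 2) (ZMod 2))) := (Algebra.linearMap (MvPolynomial (Fin 2) (ZMod 2)) (FractionRing (MvPolynomial (Fin 2) (ZMod 2)))).compDer d₀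
  let E : Derivation (ZMod 2) (FractionRing (MvPolynomial (Fin 2) (ZMod 2))) (FractionRing (MvPolynomial (Fin 2) (ZMod 2))) := dK.fractionFieldExtend (F := (FractionRing (MvPolynomial (Fin 2) (ZMod 2)))) (K := (FractionRing (MvPolynomial (Fin 2) (ZMod 2))))
  refine ⟨E, fun a => ?_⟩
  rw [Derivation.fractionFieldExtend_algebraMap, ← d₀_apply]
  rfl


/-- **`(x)` is prime for `x ∈ 𝔪 ∖ 𝔪²` in a regular local ring** (Matsumura 14.2: `R/(x)` is
regular; 14.3: hence a domain), in the pulled-back form used below: along a ring map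
`f : S → R`, if `w² = u·v` in `S` and `f u ∈ 𝔪 ∖ 𝔪²`, then `f w ∈ (f u)`.
[cite: Matsumura1987, Thm. 14.2, Thm. 14.3] -/
theorem map_mem_span_of_sq_eq {S R : Type*} [CommRing S] [CommRing R] [IsRegularLocalRing R]
    (f : S →+* R) {u v w : S} (hw : w ^ 2 = u * v) (hu : f u ∈ maximalIdeal R)
    (hu2 : f u ∉ maximalIdeal R ^ 2) : f w ∈ Ideal.span {f u} := by
  obtain ⟨hregQ, -⟩ :=
    Literature.AlgebraicGeometry.Resolution.IsRegularLocalRing.quotient_span_singleton hu hu2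
  haveI := hregQ
  have hprime : (Ideal.span {f u}).IsPrime :=
    (Ideal.Quotient.isDomain_iff_prime (Ideal.span {f u})).mp
      (Literature.AlgebraicGeometry.Resolution.isDomain_of_isRegularLocalRing
        (R ⧸ Ideal.span {f u}))
  have h2 : f w * f w ∈ Ideal.span {f u} := by
    rw [← map_mul, ← pow_two, hw, map_mul]
    exact Ideal.mul_mem_right _ _ (Ideal.mem_span_singleton_self _)
  exact (hprime.mem_or_mem h2).elim id id

/-- **Abstract form of the non-regularity argument.** Let `T` be a domain, `𝔮` a prime, `R` a
localization of `T` at `𝔮` which is a regular local ring, and `u, v, w ∈ T` with `w² = u·v`,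
`u ∈ 𝔮`, `s·u ∉ 𝔮²` for all `s ∉ 𝔮` (so `u ∈ 𝔪 ∖ 𝔪²` in `R`). Then `w ∈ (u)R`
(`map_mem_span_of_sq_eq`), i.e. `a·u = s·w` in `T` for some `s ∉ 𝔮`. Stated over an ABSTRACT
localization `R` (one `CommRing R` instance in scope), then specialised. [folklore] -/
theorem exists_mul_eq_mul_of_isRegularLocalRing {T : Type*} [CommRing T] [IsDomain T]
    (𝔮 : Ideal T) [𝔮.IsPrime] (R : Type*) [CommRing R] [Algebra T R] [IsLocalization.AtPrime R 𝔮]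
    [IsRegularLocalRing R] {u v w : T} (hw : w ^ 2 = u * v) (hu : u ∈ 𝔮)
    (hu2 : ∀ s ∉ 𝔮, s * u ∉ 𝔮 ^ 2) : ∃ s ∉ 𝔮, ∃ a : T, a * u = s * w := by
  have hmax : 𝔮.map (algebraMap T R) = maximalIdeal R :=
    IsLocalization.AtPrime.map_eq_maximalIdeal 𝔮 R
  have hm : algebraMap T R u ∈ maximalIdeal R := hmax ▸ Ideal.mem_map_of_mem _ hu
  have hm2 : algebraMap T R u ∉ maximalIdeal R ^ 2 := by
    intro h2
    rw [← hmax, ← Ideal.map_pow] at h2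
    obtain ⟨s, hs, hsu⟩ :=
      (IsLocalization.algebraMap_mem_map_algebraMap_iff 𝔮.primeCompl R _ _).mp h2
    exact hu2 s hs hsu
  have hwmem : algebraMap T R w ∈ (Ideal.span {u}).map (algebraMap T R) := by
    rw [Ideal.map_span, Set.image_singleton]
    exact map_mem_span_of_sq_eq (algebraMap T R) hw hm hm2
  obtain ⟨s, hs, hsw⟩ :=
    (IsLocalization.algebraMap_mem_map_algebraMap_iff 𝔮.primeCompl R _ _).mp hwmem
  obtain ⟨a, ha⟩ := Ideal.mem_span_singleton'.mp hsw
  exact ⟨s, hs, a, ha⟩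

end DualSandwichNaiveDescentNeg

end

end Summit.ResolutionOfSingularities.ResolutionOfSingularities.Theorems
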